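import Literature.NumberTheory.DiophantineGeometry.KroneckerTriplePoly
import Literature.Computability.AlgebraicComplexity.PlethysmStability
import HarnessLib

/-!
# Stability of rectangular Kronecker coefficients in the length of the rectangle
# (Manivel 2011, Thm. 1; Ikenmeyer–Panova 2017, Thm. 2.1)

L. Manivel, *On rectangular Kronecker coefficients*, J. Algebraic Combin. 33 (2011) 153–162,
Thm. 1: for a partition `ρ` and `λ = (dn - |ρ|, ρ)`, the rectangular Kronecker coefficient
`k_{λ,(d^n),(d^n)}` "is a symmetric, non decreasing function of `n` and `d`" and is constant for
`d ≥ |ρ|`; by the symmetry, constant for `n ≥ |ρ|`, which is the form quoted and used by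
C. Ikenmeyer, G. Panova, Adv. Math. 319 (2017), Thm. 2.1 with Rem. 2.2 (held arXiv text: Thm. 8,
Rem. 9): "If `n ≥ |ρ|` we have that `g(ρ(nd), n × d, n × d) = a_ρ(d)`", i.e. `(n, d)` lies in the
1-stable range `St¹(ρ)`; this is the ingredient of IP Prop. 2.8 (held: Prop. 15).

This file proves the upper half of the stability in the following form (tree letters:
`Nat.Partition.rectangle d n` has `d` parts equal to `n`, i.e. `d` rows of length `n`; `g` =
`kroneckerCoeff` of `SymmetricGroupReps`, over any field of characteristic zero):

* `kroneckerCoeff_rectangle_succ_le`: if `λ⁺ ⊢ d(n+1)` arises from `λ ⊢ dn` by adding `d` boxes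
  to the first row and `λ⁺₁ > (n+1)(d-1)` (equivalently `|λ̄| < n + 1`), then
  `g(λ⁺, d × (n+1), d × (n+1)) ≤ g(λ, d × n, d × n)`.

Iterating (in `OccurrenceObstructionsIPProofs.lean`, together with the transposition property
`g(λ, μ, ν) = g(λ, μᵗ, νᵗ)` of the tree) gives `g(ρ(n'd), n' × d, n' × d) ≤ g(ρ(nd), n × d, n × d)`
for `|ρ| ≤ n ≤ n'`, which is all that IP Prop. 2.8 uses of Thm. 2.1. (The printed proof of
Manivel's theorem goes through Schur–Weyl duality, Pieri's formula and the Littlewood–Richardson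
rule for rectangles, none of which is in the tree; the proof here is a direct argument in the
model `g(λ, μ, ν) = dim (HW_λ ⊗ HW_μ ⊗ HW_ν)^{S_m}` of `KroneckerSemigroup.lean`, read through the
polynomial dictionary of `KroneckerTriplePoly.lean` — Manivel's own description of the algebra
`A = ⊕_d Sym(E ⊗ F ⊗ G)^{SL(E)×SL(F)×U_G}`, `dim A_λ = k_{(d^n),(d^n),λ}`, in §3.4 of his paper.)

## Proof (`legDet_dvd_triplePoly`, the heart)

Let `D = det (X_{((0,i),j)})_{i,j<d}` (`legDet`). Multiplication by `D` maps the space of weight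
`(λ, d × n, d × n)` injectively into that of weight `(λ⁺, d × (n+1), d × (n+1))`; the inequality
says it is onto, i.e. that EVERY `P_M`, `M ∈ HW_{λ⁺} ⊗ HW_□ ⊗ HW_□` (`□ = d × (n+1)`, words of length
`m = d(n+1)`), is divisible by `D` (`finrank_symTripleHw_le_of_forall_dvd`). Write
`P_M = ∑_{u,w} ∑_v M(u,v,w) ∏_p X_{((u_p,v_p),w_p)}` and fix `u, w` with the inner sum nonzero.
Then `u` has content `λ⁺`, so exactly `λ⁺₁` letters `0`, and `w` only uses letters `< d` (weight
support, `apply_eq_zero_of_mem_highestWeightSpace`). Expand the partial function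
`v ↦ M(u,v,w) ∈ HW_□` in the polytabloids `e_S` of the standard tableaux `S` of rectangular shape
(`exists_sum_smul_polytabloid_eq`): `e_S(v) = ∑_{σ ∈ C_S} sgn σ [v = r_S ∘ σ⁻¹]`, so the inner sum is
a combination of `G_S = ∑_{σ ∈ C_S} sgn σ ∏_p X_{((u_p, r_S(σ⁻¹p)), w_p)}`. The `n+1` columns of `S`
partition the `m` positions into blocks of size `d`; since `λ⁺₁ > (n+1)(d-1)`, some column `c₀`
of `S` carries only the letter `0` of `u` (pigeonhole, `exists_col_forall_eq_zero`). Splitting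
`C_S = Sym(column c₀) × (rest)` (`sum_colStab_eq`) factors `G_S = Δ · (rest)` with
`Δ = ∑_{τ ∈ Sym(c₀)} sgn τ ∏_{q ∈ c₀} X_{((0, r_S(τ⁻¹ q)), w_q)} = det (X_{((0, r_S q), w_{q'})})_{q,q'}`,
a `d × d` minor of the `d × N` matrix of the letter `0` with all column indices `< d`: it is `± D`
if `w` is injective on the column and `0` otherwise (`legDet_dvd_det_col`). Hence `D ∣ P_M`.

## References

* L. Manivel, J. Algebraic Combin. 33 (2011) 153–162 = arXiv:0907.3351, Thm. 1, §2, §3.4.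
  [key `Manivel2011`]
* C. Ikenmeyer, G. Panova, Adv. Math. 319 (2017) 40–66 = arXiv:1512.03798, Thm. 2.1 and
  Rem. 2.2 (held: Thm. 8, Rem. 9), Prop. 2.8 (held: Prop. 15). [key `IkenmeyerPanova2017`]
* W. Fulton, *Young Tableaux*, LMS Student Texts 35, §7.2, §8.1 (polytabloids, column
  stabilisers). [key `FultonYoungTableaux1997`]
-/

noncomputable section

open scoped BigOperators

namespace Literature.NumberTheory.DiophantineGeometry

open MvPolynomial Literature.Computability.AlgebraicComplexity

/-! ### The rectangular Young diagram -/

section Rectangle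

variable {N : ℕ}

/-- The cells of the Young diagram of `rectangle d n` (`d` rows of length `n`) are the pairs
`(i, j)` with `i < d`, `j < n`. (The same statement is proved downstream as
`Literature.Computability.Complexity.mem_youngDiagram_rectangle` in
`OccurrenceObstructionsIP.lean`, which imports this part of the tree and cannot be imported here.)
[folklore] -/
theorem mem_youngDiagram_rectangle_iff (d n : ℕ) (c : ℕ × ℕ) :
    c ∈ (Nat.Partition.rectangle d n).youngDiagram ↔ c.1 < d ∧ c.2 < n := by
  rw [Nat.Partition.mem_youngDiagram_iff]
  by_cases hn : n = 0
  · subst hn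
    have h0 : (Nat.Partition.rectangle d 0).sortedParts = [] := by
      rw [← List.length_eq_zero_iff, Nat.Partition.length_sortedParts]
      simp [Nat.Partition.rectangle, Nat.Partition.ofSums]
    simp [h0]
  · simp [Nat.Partition.sortedParts_rectangle d n hn]

/-- The rectangle `d × n` has `d n` cells. [folklore] -/
theorem card_youngDiagram_rectangle (d n : ℕ) :
    (Nat.Partition.rectangle d n).youngDiagram.cells.card = d * n := by
  classical
  have h : (Nat.Partition.rectangle d n).youngDiagram.cells =
      (Finset.range d ×ˢ Finset.range n) := by
    ext c
    rw [YoungDiagram.mem_cells, mem_youngDiagram_rectangle_iff, Finset.mem_product, Finset.mem_range,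
      Finset.mem_range]
  rw [h, Finset.card_product, Finset.card_range, Finset.card_range]

/-- The cells of the rectangle lie in rows `< N` as soon as `d ≤ N`. [folklore] -/
theorem fst_lt_of_mem_rectangle {d n : ℕ} (hd : d ≤ N) :
    ∀ x ∈ (Nat.Partition.rectangle d n).youngDiagram.cells, x.1 < N := fun x hx =>
  lt_of_lt_of_le ((mem_youngDiagram_rectangle_iff d n x).1 ((YoungDiagram.mem_cells _).1 hx)).1 hd

/-- **The weight of the rectangle**: `n` on the first `d` letters, `0` elsewhere. [folklore] -/
theorem ofPartition_rectangle_eq (N d n : ℕ) :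
    Weight.ofPartition N (Nat.Partition.rectangle d n) =
      fun i : Fin N => if (i : ℕ) < d then (n : ℤ) else 0 := by
  funext i
  rw [Weight.ofPartition]
  by_cases hn : n = 0
  · subst hn
    have h0 : (Nat.Partition.rectangle d 0).sortedParts = [] := by
      rw [← List.length_eq_zero_iff, Nat.Partition.length_sortedParts]
      simp [Nat.Partition.rectangle, Nat.Partition.ofSums]
    simp [h0]
  · rw [Nat.Partition.sortedParts_rectangle d n hn, List.getD_eq_getElem?_getD, List.getElem?_replicate]
    split_ifs <;> simp

/-- The weight of the rectangle `d × n` is `n` times the weight `1^d` (`colWeight`). [folklore] -/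
theorem ofPartition_rectangle_eq_smul_colWeight (N d n : ℕ) :
    Weight.ofPartition N (Nat.Partition.rectangle d n) = (n : ℤ) • colWeight N d := by
  rw [ofPartition_rectangle_eq]
  funext i
  simp only [colWeight, Pi.smul_apply, smul_eq_mul]
  split_ifs <;> simp

/-- `□_{n+1} - 1^d = □_n` on weights. [folklore] -/
theorem ofPartition_rectangle_succ_sub_colWeight (N d n : ℕ) :
    Weight.ofPartition N (Nat.Partition.rectangle d (n + 1)) - colWeight N d =
      Weight.ofPartition N (Nat.Partition.rectangle d n) := by
  rw [ofPartition_rectangle_eq_smul_colWeight, ofPartition_rectangle_eq_smul_colWeight]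
  funext i
  simp only [Pi.sub_apply, Pi.smul_apply, smul_eq_mul]
  push_cast
  ring

end Rectangle

/-! ### Columns of a standard tableau of rectangular shape -/

section Columns

variable {d n m : ℕ}

/-- In a standard filling of the rectangle `d × n` by `m = dn` entries, every column has exactly
`d` entries. [folklore] -/
theorem card_filter_col_eq (hm : (Nat.Partition.rectangle d n).youngDiagram.cells.card = m)
    (S : StdFilling m (Nat.Partition.rectangle d n).youngDiagram) {c : ℕ} (hc : c < n) :
    (Finset.univ.filter fun p : Fin m => (S.1 p).2 = c).card = d := by
  classical
  suffices h : (Finset.univ.filter fun p : Fin m => (S.1 p).2 = c).card = (Finset.range d).card by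
    rwa [Finset.card_range] at h
  refine Finset.card_bij (fun p _ => (S.1 p).1) ?_ ?_ ?_
  · intro p hp
    rw [Finset.mem_range]
    exact ((mem_youngDiagram_rectangle_iff d n _).1 (S.mem p)).1
  · intro p hp q hq h
    simp only [Finset.mem_filter, Finset.mem_univ, true_and] at hp hq
    exact S.injective (Prod.ext h (hp.trans hq.symm))
  · intro i hi
    rw [Finset.mem_range] at hi
    obtain ⟨p, hp⟩ := S.exists_eq hm ((mem_youngDiagram_rectangle_iff d n (i, c)).2 ⟨hi, hc⟩)
    refine ⟨p, ?_, by rw [hp]⟩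
    simp only [Finset.mem_filter, Finset.mem_univ, true_and]
    rw [hp]

/-- The number of entries in column `c₀`, as the cardinality of the subtype. [folklore] -/
theorem card_subtype_col_eq (hm : (Nat.Partition.rectangle d n).youngDiagram.cells.card = m)
    (S : StdFilling m (Nat.Partition.rectangle d n).youngDiagram) {c : ℕ} (hc : c < n) :
    Fintype.card {p : Fin m // (S.1 p).2 = c} = d := by
  classical
  rw [Fintype.card_subtype]
  exact card_filter_col_eq hm S hc

/-- **Pigeonhole on the columns.** If a word `u` of length `m = dn` has more than `n (d - 1)`
letters `0` (`1 ≤ d`), then some column of the standard tableau `S` of shape `d × n` carries only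
the letter `0` of `u`. [folklore] -/
theorem exists_col_forall_eq_zero {N : ℕ} [NeZero N]
    (hm : (Nat.Partition.rectangle d n).youngDiagram.cells.card = m)
    (S : StdFilling m (Nat.Partition.rectangle d n).youngDiagram) (u : Word N m)
    (hu : n * (d - 1) < wordContent u 0) :
    ∃ c₀, c₀ < n ∧ ∀ p : Fin m, (S.1 p).2 = c₀ → u p = 0 := by
  classical
  by_contra hcon
  push Not at hcon
  -- every column has an entry with a nonzero letter
  have hcol : ∀ c, c < n →
      ((Finset.univ.filter fun p : Fin m => u p = 0).filter fun p => (S.1 p).2 = c).card ≤ d - 1 := by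
    intro c hc
    obtain ⟨p₀, hp₀c, hp₀⟩ := hcon c hc
    have hsub : ((Finset.univ.filter fun p : Fin m => u p = 0).filter fun p => (S.1 p).2 = c) ⊆
        (Finset.univ.filter fun p : Fin m => (S.1 p).2 = c).erase p₀ := by
      intro p hp
      simp only [Finset.mem_filter, Finset.mem_univ, true_and] at hp
      rw [Finset.mem_erase]
      refine ⟨?_, by simpa using hp.2⟩
      rintro rfl
      exact hp₀ hp.1
    refine (Finset.card_le_card hsub).trans ?_
    rw [Finset.card_erase_of_mem (by simpa using hp₀c), card_filter_col_eq hm S hc]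
  -- count the zeros column by column
  have hcount : wordContent u 0 =
      ∑ c ∈ Finset.range n, ((Finset.univ.filter fun p : Fin m => u p = 0).filter
        fun p => (S.1 p).2 = c).card := by
    rw [wordContent]
    exact Finset.card_eq_sum_card_fiberwise (f := fun p : Fin m => (S.1 p).2) fun p _ =>
      Finset.mem_range.2 ((mem_youngDiagram_rectangle_iff d n _).1 (S.mem p)).2
  have hle : wordContent u 0 ≤ n * (d - 1) := by
    rw [hcount]
    calc ∑ c ∈ Finset.range n, ((Finset.univ.filter fun p : Fin m => u p = 0).filter
            fun p => (S.1 p).2 = c).card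
        ≤ ∑ _c ∈ Finset.range n, (d - 1) := Finset.sum_le_sum fun c hc => hcol c (Finset.mem_range.1 hc)
      _ = n * (d - 1) := by rw [Finset.sum_const, Finset.card_range, smul_eq_mul]
  omega

/-- **Splitting the column stabiliser along one column.** The column stabiliser `C_S` of a
filling is the product of the full symmetric group of the entries of column `c₀` and the
column-preserving permutations of the other entries: sums over `C_S` factor accordingly
(`Equiv.Perm.subtypeCongr`). [folklore] -/
theorem sum_colStab_eq {Y : YoungDiagram} {R : Type*} [AddCommMonoid R] (S : StdFilling m Y) (c₀ : ℕ)
    (F : Equiv.Perm (Fin m) → R) :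
    ∑ σ ∈ S.colStab, F σ =
      ∑ τ : Equiv.Perm {p : Fin m // (S.1 p).2 = c₀},
        ∑ ν ∈ (Finset.univ.filter fun ν : Equiv.Perm {p : Fin m // ¬ (S.1 p).2 = c₀} =>
          ∀ q, (S.1 (ν q : Fin m)).2 = (S.1 (q : Fin m)).2),
          F (τ.subtypeCongr ν) := by
  classical
  rw [← Finset.sum_product']
  symm
  refine Finset.sum_bij' (fun x _ => x.1.subtypeCongr x.2)
    (fun σ hσ => (σ.subtypePerm fun p => ?_, σ.subtypePerm fun p => ?_)) ?_ ?_ ?_ ?_ ?_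
  · -- `σ` preserves the column `c₀`
    rw [StdFilling.mem_colStab] at hσ
    rw [hσ p]
  · rw [StdFilling.mem_colStab] at hσ
    rw [hσ p]
  · -- the product lands in `C_S`
    rintro ⟨τ, ν⟩ hx
    simp only [Finset.mem_product, Finset.mem_univ, true_and, Finset.mem_filter] at hx
    rw [StdFilling.mem_colStab]
    intro p
    dsimp only
    by_cases hp : (S.1 p).2 = c₀
    · rw [Equiv.Perm.subtypeCongr.left_apply τ ν hp, hp]
      exact (τ ⟨p, hp⟩).2
    · rw [Equiv.Perm.subtypeCongr.right_apply τ ν hp]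
      exact hx ⟨p, hp⟩
  · -- the restrictions land in the product
    intro σ hσ
    simp only [Finset.mem_product, Finset.mem_univ, true_and, Finset.mem_filter]
    intro q
    rw [Equiv.Perm.subtypePerm_apply]
    exact (StdFilling.mem_colStab.1 hσ) q
  · -- left inverse
    rintro ⟨τ, ν⟩ hx
    simp only [Prod.mk.injEq]
    constructor
    · refine Equiv.ext fun q => Subtype.ext ?_
      rw [Equiv.Perm.subtypePerm_apply]
      exact Equiv.Perm.subtypeCongr.left_apply_subtype τ ν q
    · refine Equiv.ext fun q => Subtype.ext ?_
      rw [Equiv.Perm.subtypePerm_apply]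
      exact Equiv.Perm.subtypeCongr.right_apply_subtype τ ν q
  · -- right inverse
    intro σ hσ
    refine Equiv.ext fun p => ?_
    dsimp only
    by_cases hp : (S.1 p).2 = c₀
    · simp [hp]
    · simp [hp]
  · -- values
    rintro ⟨τ, ν⟩ hx
    rfl

end Columns

/-! ### The column minor is a multiple of `D` -/

section Minor

variable {k : Type*} [Field k] {N d : ℕ} [NeZero N]

/-- **A `d × d` minor of the `d × N` matrix `(X_{((0,i),j)})` with all indices `< d` is `± D` or
`0`.** For index maps `r, w : P → Fin N` from a type with `d` elements, with values `< d` and `r`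
injective, `det (X_{((0, r q), w q')})_{q, q'}` is divisible by `D = det (X_{((0,i),j)})_{i,j<d}`:
zero if `w` is not injective (two equal columns), and `sign · D` otherwise (both `r` and `w` are
then bijections onto `{0, …, d-1}`). [folklore] -/
theorem legDet_dvd_det_col (hd : d ≤ N) {P : Type*} [Fintype P] [DecidableEq P]
    (hP : Fintype.card P = d) (r w : P → Fin N) (hr : Function.Injective r)
    (hrd : ∀ q, (r q : ℕ) < d) (hwd : ∀ q, (w q : ℕ) < d) :
    legDet k hd ∣ (Matrix.of fun q q' : P => (X (((0 : Fin N), r q), w q') : MvPolynomial (Alpha N) k)).det := by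
  classical
  by_cases hw : Function.Injective w
  · -- both index maps are bijections onto `Fin d`
    let fR : P → Fin d := fun q => ⟨r q, hrd q⟩
    let fW : P → Fin d := fun q => ⟨w q, hwd q⟩
    have hfR : Function.Bijective fR := by
      rw [Fintype.bijective_iff_injective_and_card, hP, Fintype.card_fin]
      exact ⟨fun q q' h => hr (Fin.ext (by simpa [fR] using congrArg Fin.val h)), rfl⟩
    have hfW : Function.Bijective fW := by
      rw [Fintype.bijective_iff_injective_and_card, hP, Fintype.card_fin]
      exact ⟨fun q q' h => hw (Fin.ext (by simpa [fW] using congrArg Fin.val h)), rfl⟩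
    let eR : P ≃ Fin d := Equiv.ofBijective fR hfR
    let eW : P ≃ Fin d := Equiv.ofBijective fW hfW
    have hY : (Matrix.of fun q q' : P => (X (((0 : Fin N), r q), w q') : MvPolynomial (Alpha N) k)) =
        (legDetMatrix k hd).submatrix eR eW := by
      ext q q'
      simp [Matrix.submatrix_apply, legDetMatrix_apply, eR, eW, fR, fW]
    have hsub : (legDetMatrix k hd).submatrix eR eW =
        ((legDetMatrix k hd).submatrix id (eR.symm.trans eW)).submatrix eR eR := by
      rw [Matrix.submatrix_submatrix]
      congr 1
      funext q
      simp
    rw [hY, hsub, Matrix.det_submatrix_equiv_self, Matrix.det_permute']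
    exact Dvd.intro_left _ rfl
  · -- two equal columns
    obtain ⟨q, q', hqq, hne⟩ : ∃ q q', w q = w q' ∧ q ≠ q' := by
      by_contra hcon
      push Not at hcon
      exact hw fun q q' h => hcon q q' h
    rw [Matrix.det_zero_of_column_eq hne (fun q'' => by simp [Matrix.of_apply, hqq])]
    exact dvd_zero _

end Minor

/-! ### Divisibility of the polynomial of a triple tensor by `D` -/

section Divisibility

variable {k : Type*} [Field k] [CharZero k] {N d n m : ℕ} [NeZero N]

/-- **The heart of the stability theorem.** Let `□ = d × n` and let `M ∈ HW_{χ₁} ⊗ HW_□ ⊗ HW_□`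
be a triple tensor of length `m = dn` whose first weight has `χ₁(0) > n (d - 1)`. Then
`D = det (X_{((0,i),j)})_{i,j<d}` divides the polynomial `P_M` (module docstring, §Proof).
[cite: Manivel2011, Thm. 1 (stability); IkenmeyerPanova2017, Thm. 2.1 (held: Thm. 8)] -/
theorem legDet_dvd_triplePoly (hd : d ≤ N) (hm : (Nat.Partition.rectangle d n).youngDiagram.cells.card = m)
    {χ₁ : Weight (Fin N)} (h0 : (n : ℤ) * ((d : ℤ) - 1) < χ₁ 0) {M : Word3 N m → k}
    (hM : M ∈ tripleHw k N m χ₁ (Weight.ofPartition N (Nat.Partition.rectangle d n))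
      (Weight.ofPartition N (Nat.Partition.rectangle d n))) :
    legDet k hd ∣ triplePoly M := by
  classical
  -- trivial case `d = 0`: `D = 1`
  rcases Nat.eq_zero_or_pos d with rfl | hdpos
  · have : legDet k hd = 1 := by simp [legDet, Matrix.det_isEmpty]
    rw [this]; exact one_dvd _
  set Y := (Nat.Partition.rectangle d n).youngDiagram with hYdef
  have hN : ∀ x ∈ Y.cells, x.1 < N := fst_lt_of_mem_rectangle hd
  have hwt : ydWeight N Y = Weight.ofPartition N (Nat.Partition.rectangle d n) := ydWeight_youngDiagram N _
  obtain ⟨h1, h2, h3⟩ := (mem_tripleHw_iff _ _ _ M).1 hM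
  -- `P_M = ∑_u ∑_w T(u, w)`
  let mono : Word N m → Word N m → Word N m → MvPolynomial (Alpha N) k := fun u v w =>
    ∏ p, X (((u p, v p), w p) : Alpha N)
  let T : Word N m → Word N m → MvPolynomial (Alpha N) k := fun u w =>
    ∑ v : Word N m, C (M ((u, v), w)) * mono u v w
  have hP : triplePoly M = ∑ u : Word N m, ∑ w : Word N m, T u w := by
    rw [triplePoly_eq_sum, Fintype.sum_prod_type, Fintype.sum_prod_type]
    refine Finset.sum_congr rfl fun u _ => ?_
    rw [Finset.sum_comm]
    rfl
  rw [hP]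
  refine Finset.dvd_sum fun u _ => Finset.dvd_sum fun w _ => ?_
  -- fix `u, w`; the partial function `f = M(u, ·, w)`
  set f : Word N m → k := fun v => M ((u, v), w) with hfdef
  by_cases hf : f = 0
  · have hT : T u w = 0 := by
      refine Finset.sum_eq_zero fun v _ => ?_
      have : M ((u, v), w) = 0 := congrFun hf v
      rw [this, map_zero, zero_mul]
    rw [hT]; exact dvd_zero _
  obtain ⟨v₀, hv₀⟩ : ∃ v₀, f v₀ ≠ 0 := by
    by_contra hcon; push Not at hcon; exact hf (funext hcon)
  -- contents of `u` and `w`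
  have hu0 : n * (d - 1) < wordContent u 0 := by
    have hc : (wordContent u 0 : ℤ) = χ₁ 0 := by
      by_contra hne
      exact hv₀ (apply_eq_zero_of_mem_highestWeightSpace k (h1 v₀ w) hne)
    have h1d : (1 : ℤ) ≤ d := by exact_mod_cast hdpos
    have : ((n * (d - 1) : ℕ) : ℤ) < wordContent u 0 := by
      rw [hc]; push_cast [Nat.cast_sub hdpos]; exact h0
    exact_mod_cast this
  have hwd : ∀ p, (w p : ℕ) < d := by
    intro p
    by_contra hle
    have hcw : (wordContent w (w p) : ℤ) = Weight.ofPartition N (Nat.Partition.rectangle d n) (w p) := by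
      by_contra hne
      exact hv₀ (apply_eq_zero_of_mem_highestWeightSpace k (h3 u v₀) hne)
    rw [ofPartition_rectangle_eq] at hcw
    simp only [if_neg hle, Nat.cast_eq_zero, wordContent, Finset.card_eq_zero,
      Finset.filter_eq_empty_iff] at hcw
    exact hcw (Finset.mem_univ p) rfl
  -- expand `f` in polytabloids
  have hfHW : f ∈ highestWeightSpace (wordRep k N m) (ydWeight N Y) := by
    rw [hwt]; exact h2 u w
  obtain ⟨a, ha⟩ := exists_sum_smul_polytabloid_eq hN hm hfHW
  -- `T(u,w) = ∑_S a_S · G_S`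
  let G : StdFilling m Y → MvPolynomial (Alpha N) k := fun S =>
    ∑ σ ∈ S.colStab, C (((Equiv.Perm.sign σ : ℤ) : k)) * mono u (S.rowWord hN ∘ ⇑σ⁻¹) w
  have hT : T u w = ∑ S, C (a S) * G S := by
    have hfv : ∀ v, M ((u, v), w) = ∑ S, a S * S.polytabloid k hN v := by
      intro v
      have := congrFun ha v
      simp only [Finset.sum_apply, Pi.smul_apply, smul_eq_mul] at this
      exact this.symm
    simp only [T, hfv, map_sum, map_mul, Finset.sum_mul]
    rw [Finset.sum_comm]
    refine Finset.sum_congr rfl fun S _ => ?_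
    simp only [G, Finset.mul_sum]
    -- `∑_v a_S e_S(v) mono(v) = ∑_{σ ∈ C_S} a_S sgn σ mono(r ∘ σ⁻¹)`
    simp only [StdFilling.polytabloid_apply, map_sum, Finset.sum_mul, Finset.mul_sum]
    rw [Finset.sum_comm]
    refine Finset.sum_congr rfl fun σ _ => ?_
    rw [Finset.sum_eq_single (S.rowWord hN ∘ ⇑σ⁻¹)]
    · simp [mul_assoc]
    · intro v _ hv
      rw [if_neg hv, map_zero, mul_zero, zero_mul]
    · intro h; exact absurd (Finset.mem_univ _) h
  rw [hT]
  refine Finset.dvd_sum fun S _ => dvd_mul_of_dvd_right ?_ _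
  -- the column `c₀` of `S` carrying only zeros of `u`
  obtain ⟨c₀, hc₀, hcol⟩ := exists_col_forall_eq_zero hm S u hu0
  -- split the column stabiliser
  let P₀ := {p : Fin m // (S.1 p).2 = c₀}
  set r : Word N m := S.rowWord hN with hr
  -- the factor of column `c₀`
  let A : Equiv.Perm P₀ → MvPolynomial (Alpha N) k := fun τ =>
    C (((Equiv.Perm.sign τ : ℤ) : k)) * ∏ q : P₀, X ((((0 : Fin N), r (τ⁻¹ q : P₀)), w q) : Alpha N)
  let B : Equiv.Perm {p : Fin m // ¬ (S.1 p).2 = c₀} → MvPolynomial (Alpha N) k := fun ν =>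
    C (((Equiv.Perm.sign ν : ℤ) : k)) *
      ∏ q : {p : Fin m // ¬ (S.1 p).2 = c₀}, X (((u q, r (ν⁻¹ q : {p : Fin m // ¬ (S.1 p).2 = c₀})), w q) : Alpha N)
  have hG : G S = (∑ τ, A τ) *
      ∑ ν ∈ (Finset.univ.filter fun ν : Equiv.Perm {p : Fin m // ¬ (S.1 p).2 = c₀} =>
        ∀ q, (S.1 (ν q : Fin m)).2 = (S.1 (q : Fin m)).2), B ν := by
    simp only [G]
    rw [sum_colStab_eq S c₀, Finset.sum_mul_sum]
    refine Finset.sum_congr rfl fun τ _ => Finset.sum_congr rfl fun ν _ => ?_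
    -- the summand at `σ = τ.subtypeCongr ν`
    have hinv : (τ.subtypeCongr ν)⁻¹ = τ⁻¹.subtypeCongr ν⁻¹ := Equiv.Perm.subtypeCongr.symm τ ν
    simp only [A, B, mono, hinv, Equiv.Perm.sign_subtypeCongr]
    rw [← Fintype.prod_subtype_mul_prod_subtype (fun p : Fin m => (S.1 p).2 = c₀)]
    have hl : ∀ q : P₀, ((τ⁻¹.subtypeCongr ν⁻¹) (q : Fin m) : Fin m) = (τ⁻¹ q : P₀) := fun q =>
      Equiv.Perm.subtypeCongr.left_apply_subtype _ _ q
    have hr' : ∀ q : {p : Fin m // ¬ (S.1 p).2 = c₀},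
        ((τ⁻¹.subtypeCongr ν⁻¹) (q : Fin m) : Fin m) = (ν⁻¹ q : {p : Fin m // ¬ (S.1 p).2 = c₀}) := fun q =>
      Equiv.Perm.subtypeCongr.right_apply_subtype _ _ q
    have hu0' : ∀ q : P₀, u (q : Fin m) = 0 := fun q => hcol q q.2
    simp only [Function.comp_apply, hl, hr', hu0', ← hr]
    push_cast
    rw [map_mul]
    ring
  rw [hG]
  refine dvd_mul_of_dvd_left ?_ _
  -- `∑ τ, A τ` is the column minor `det (X_{((0, r q), w q')})_{q, q' ∈ P₀}`
  have hdet : ∑ τ, A τ =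
      (Matrix.of fun q q' : P₀ => (X (((0 : Fin N), r q), w q') : MvPolynomial (Alpha N) k)).det := by
    rw [Matrix.det_apply']
    refine Fintype.sum_equiv (Equiv.inv (Equiv.Perm P₀)) _ _ fun τ => ?_
    simp only [A, Equiv.inv_apply, Equiv.Perm.sign_inv, Matrix.of_apply, map_intCast]
  rw [hdet]
  refine legDet_dvd_det_col hd (card_subtype_col_eq hm S hc₀) (fun q : P₀ => r q) (fun q : P₀ => w q)
    ?_ ?_ ?_
  · -- `r` is injective on a column
    intro q q' h
    apply Subtype.ext
    apply S.injective
    refine Prod.ext ?_ (q.2.trans q'.2.symm)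
    have := congrArg Fin.val h
    simpa [r] using this
  · intro q
    exact ((mem_youngDiagram_rectangle_iff d n _).1 (S.mem q)).1
  · intro q
    exact hwd q

end Divisibility

/-! ### The stability step -/

section Stability

variable (k : Type*) [Field k] [CharZero k] {N d n : ℕ} [NeZero N]

/-- **Stability of rectangular Kronecker coefficients, one step (Manivel 2011, Thm. 1; IP 2017,
Thm. 2.1 = held Thm. 8, upper half).** Let `λ ⊢ dn` and `λ⁺ ⊢ d(n+1)` have the same rows except
that the first row of `λ⁺` is longer by `d` (`ofPartition N λ⁺ = ofPartition N λ + d ε₀`), with at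
most `N ≥ d` rows, and assume `λ⁺₁ > (n+1)(d-1)` (i.e. `|λ̄| ≤ n`: the body is short). Then
`g(λ⁺, d × (n+1), d × (n+1)) ≤ g(λ, d × n, d × n)` (`rectangle d n` = `d` rows of length `n`).
Proof: both sides are dimensions of spaces of symmetric triple tensors (`finrank_symTripleHw`),
and division by `D` is an injective linear map from the former to the latter
(`finrank_symTripleHw_le_of_forall_dvd`), every polynomial of the former being divisible by `D`
(`legDet_dvd_triplePoly`). In print (Manivel): "`k_ρ(d,n)` … is constant for `d ≥ |ρ|`" (with the
symmetry `k_ρ(d,n) = k_ρ(n,d)`); IP: "If `n ≥ |ρ|` we have that `g(ρ(nd), n × d, n × d) = a_ρ(d)`".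
[cite: Manivel2011, Thm. 1; IkenmeyerPanova2017, Thm. 2.1 (held: Thm. 8)] -/
theorem kroneckerCoeff_rectangle_succ_le (hd : d ≤ N)
    (lam : Nat.Partition (d * n)) (lamBig : Nat.Partition (d * n + d))
    (hl : lam.parts.card ≤ N) (hL : lamBig.parts.card ≤ N)
    (hrel : Weight.ofPartition N lamBig = Weight.ofPartition N lam + Pi.single 0 (d : ℤ))
    (hbig : ((n : ℤ) + 1) * ((d : ℤ) - 1) < Weight.ofPartition N lamBig 0) :
    kroneckerCoeff k lamBig (Nat.Partition.rectangle d (n + 1)) (Nat.Partition.rectangle d (n + 1)) ≤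
      kroneckerCoeff k lam (Nat.Partition.rectangle d n) (Nat.Partition.rectangle d n) := by
  have hrect : ∀ n', (Nat.Partition.rectangle d n').parts.card ≤ N := fun n' =>
    (Nat.Partition.card_parts_rectangle_le d n').trans hd
  rw [← finrank_symTripleHw (k := k) (N := N) lamBig _ _ hL (hrect _) (hrect _),
    ← finrank_symTripleHw (k := k) (N := N) lam _ _ hl (hrect _) (hrect _)]
  have hw1 : Weight.ofPartition N lam = Weight.ofPartition N lamBig - detWeight₁ N d := by
    rw [hrel, detWeight₁, add_sub_cancel_right]
  have hw2 : Weight.ofPartition N (Nat.Partition.rectangle d n) =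
      Weight.ofPartition N (Nat.Partition.rectangle d (n + 1)) - colWeight N d :=
    (ofPartition_rectangle_succ_sub_colWeight N d n).symm
  rw [hw1, hw2]
  refine finrank_symTripleHw_le_of_forall_dvd hd _ _ _ fun M hM => ?_
  refine legDet_dvd_triplePoly hd ?_ ?_ hM.1
  · rw [card_youngDiagram_rectangle]; ring
  · push_cast; linarith

end Stability

end Literature.NumberTheory.DiophantineGeometry
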